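import Summits.BirchSwinnertonDyer.BirchSwinnertonDyer.Theorems.CyclotomicUntwistCandidateUniqueness
import HarnessLib

/-!
# F1 from a LATTICE, I: the unstable recursion of the Mazur–Tate–Teitelbaum candidate, growth `½`
# from a bound on its ball values, and boundedness of a finitely generated `ℤ`-module under `K →+* ℂ_p`

Cell `pub/bsd-wall` (D-0145 line `route-BirchSwinnertonDyer-CyclotomicUntwist`), seat `bsd-line-cycu-p3`
(prover seat 3/3, gen 9). THEOREMS ONLY (no definition, no named fact, no `sorry`); helper toward the crux
child C1 = stmt-BirchSwinnertonDyer-27548 (`PSUntwistedLFunctionAtThree`), whose research residual after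
`CyclotomicUntwistFiniteSlopeSeparatedPinnedLogNormPrint.hEX'_of_print` is F1′: «`∃ η α 𝓛`, `η` primitive,
`α² − a_w α + 3 = 0`, `IsPSCyclotomicLFunctionOf W η α 𝓛`». BSD is not proved by this file; no crux and no
child of the route is proved by it; K1/K2 stay OPEN and WHOLE. First of two files (this file §1–§3; the
sequel `CyclotomicUntwistF1OfLattice` §4–§6 does the complex side and the assembly).

WHAT. By `PSCandidateUniqueness.exists_isUntwistedPAdicLFunction_iff_hasGrowthOrder_(map_)candidate`
(cycu-p5) F1 is ONE inequality: growth of order `½` for the explicit candidate `𝓛` of `PSF1Reduction`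
(cycu-p1), whose level-`M` Mazur–Tate–Teitelbaum ball values are
`ν_M(x) = ∑_{i<M} α^{-(i+1)} p^{i+1-M} S_{i+1}(x) + p^{-M}(1 − α/p)⁻¹ S₀`,
`S_j(y) = ∑_b η(b) [y/p^j + b/p^c]⁺_f`.  This file:

* §1 `nu_zero`, `nu_succ`, `alpha_pow_mul_nu_succ` — the candidate obeys the UNSTABLE recursion
  `ν_{M+1}(x) = p⁻¹ ν_M(x̄) + α^{-(M+1)} S_{M+1}(x)`, i.e. `Φ_M := α^M ν_M` satisfies
  `Φ_{M+1}(x) = S_{M+1}(x) + (α/p) Φ_M(x̄)`, `Φ₀ = (1 − α/p)⁻¹ S₀` (any field, `α ≠ 0`, `p ≠ 0`):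
  the `p`-deprivation identity `{∞,r}_g − (α/p){∞,pr}_g = {∞,r}_{f⊗η̄}` of the untwist `g`, read at
  `r = x/p^{M+1}`.
* §2 `hasGrowthOrder_half_candidate_of_norm_nu_le` — `‖ν_M(x)‖ ≤ K p^{M/2}` for all `M`, `x` gives
  `HasGrowthOrder p ½ 𝓛` (the pushforward only sums `ρ = η̄ ν` at level `c + e₀ + n`; ultrametric);
  `norm_nu_le_of_norm_alpha_pow_mul_nu_le` — `‖α^M ν_M(x)‖ ≤ C` and `‖α⁻¹‖ ≤ √p` give that bound.
* §3 `exists_norm_map_le_of_fg` — over a coefficient field `K` with `ι_p : K →+* ℂ_p`: a finitely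
  generated `ℤ`-submodule of `K` has bounded image under `ι_p` (`‖n‖ ≤ 1` for `n ∈ ℤ` in `ℂ_p`).

So growth `½` — hence F1 — follows as soon as the `α^M ν_M(x)`, computed over a number field `K`, lie in ONE
finitely generated `ℤ`-module; the sequel derives that from a complex untwist symbol with lattice values.

References: [cite: MazurTateTeitelbaum1986Invent, §I.10–§I.11 and §I.13–§I.14 (case p ∣ N)] ·
[cite: Bellaiche2021, Def. 6.2.10, Thm. 6.2.13, Thm. 6.7.9].
-/

noncomputable section

open scoped MatrixGroups

open CongruenceSubgroup DirichletCharacter Literature.NumberTheory.EllipticCurves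
  Literature.NumberTheory.EllipticCurves.ModularForms Literature.NumberTheory.IwasawaTheory
  Summit.BirchSwinnertonDyer.BirchSwinnertonDyer.Theorems.PSF1Reduction
  Summit.BirchSwinnertonDyer.BirchSwinnertonDyer.Theorems.PSCandidateUniqueness

-- single-conjunct summit: `Summit.BirchSwinnertonDyer.BirchSwinnertonDyer.…` repeats the name by design
set_option linter.dupNamespace false
set_option autoImplicit false

namespace Summit.BirchSwinnertonDyer.BirchSwinnertonDyer.Theorems.PSF1OfLattice

variable {p : ℕ}

/-! ### §1 The unstable recursion of the candidate (any field) -/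

section Recursion

variable [Fact p.Prime] {F : Type*} [Field F]
variable {c : ℕ} (α : F) (S : (j : ℕ) → ZMod (p ^ j) → F)
variable (ν : (M : ℕ) → ZMod (p ^ M) → F)
variable (hν : ∀ (M : ℕ) (x : ZMod (p ^ M)), ν M x =
  (∑ i ∈ Finset.range M, α⁻¹ ^ (i + 1) * ((p : F) ^ (i + 1) / (p : F) ^ M) *
      S (i + 1) ((x.val : ℕ) : ZMod (p ^ (i + 1)))) +
    ((p : F) ^ M)⁻¹ * (1 - α / p)⁻¹ * S 0 0)

/-- Reducing `x mod p^{M+1}` to `ZMod (p^j)`, `j ≤ M`, through `ZMod (p^M)` or directly gives the same class.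
[folklore] -/
theorem natCast_val_castHom_eq {M j : ℕ} (hj : j ≤ M) (x : ZMod (p ^ (M + 1))) :
    (((ZMod.castHom (pow_dvd_pow p M.le_succ) (ZMod (p ^ M)) x).val : ℕ) : ZMod (p ^ j)) =
      ((x.val : ℕ) : ZMod (p ^ j)) := by
  haveI : NeZero (p ^ (M + 1)) := ⟨pow_ne_zero _ (Fact.out : p.Prime).ne_zero⟩
  haveI : NeZero (p ^ M) := ⟨pow_ne_zero _ (Fact.out : p.Prime).ne_zero⟩
  rw [ZMod.castHom_apply, ZMod.cast_eq_val, ZMod.val_natCast, ZMod.natCast_eq_natCast_iff']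
  exact Nat.mod_mod_of_dvd _ (pow_dvd_pow p hj)

include hν in
omit [Fact p.Prime] in
/-- **Level `0`**: `ν₀ = (1 − α/p)⁻¹ S₀`. [cite: MazurTateTeitelbaum1986Invent, §I.10] -/
theorem nu_zero (x : ZMod (p ^ 0)) : ν 0 x = (1 - α / p)⁻¹ * S 0 0 := by
  rw [hν]; simp

include hν in
/-- **The unstable recursion**: `ν_{M+1}(x) = p⁻¹ · ν_M(x mod p^M) + α^{-(M+1)} S_{M+1}(x)` (`p ≠ 0` in `F`).
[cite: MazurTateTeitelbaum1986Invent, §I.10] -/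
theorem nu_succ (hp : (p : F) ≠ 0) (M : ℕ) (x : ZMod (p ^ (M + 1))) :
    ν (M + 1) x = (p : F)⁻¹ * ν M (ZMod.castHom (pow_dvd_pow p M.le_succ) (ZMod (p ^ M)) x) +
      α⁻¹ ^ (M + 1) * S (M + 1) x := by
  haveI : NeZero (p ^ (M + 1)) := ⟨pow_ne_zero _ (Fact.out : p.Prime).ne_zero⟩
  rw [hν, hν, Finset.sum_range_succ, ZMod.natCast_zmod_val, div_self (pow_ne_zero _ hp), mul_one]
  have hterm : ∀ i ∈ Finset.range M,
      α⁻¹ ^ (i + 1) * ((p : F) ^ (i + 1) / (p : F) ^ (M + 1)) * S (i + 1) ((x.val : ℕ) : ZMod (p ^ (i + 1))) =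
        (p : F)⁻¹ * (α⁻¹ ^ (i + 1) * ((p : F) ^ (i + 1) / (p : F) ^ M) *
          S (i + 1) ((((ZMod.castHom (pow_dvd_pow p M.le_succ) (ZMod (p ^ M)) x).val : ℕ) :
            ZMod (p ^ (i + 1))))) := by
    intro i hi
    rw [natCast_val_castHom_eq (Nat.succ_le_of_lt (Finset.mem_range.mp hi)), pow_succ]
    field_simp
    ring
  have h1 : ((p : F) ^ (M + 1))⁻¹ = (p : F)⁻¹ * ((p : F) ^ M)⁻¹ := by
    rw [pow_succ, mul_inv, mul_comm]
  rw [Finset.sum_congr rfl hterm, ← Finset.mul_sum, h1]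
  ring

include hν in
/-- **The recursion for `Φ_M := α^M ν_M`**: `α^{M+1} ν_{M+1}(x) = S_{M+1}(x) + (α/p) · α^M ν_M(x mod p^M)`
(`α ≠ 0`, `p ≠ 0`). [cite: MazurTateTeitelbaum1986Invent, §I.10] -/
theorem alpha_pow_mul_nu_succ (hp : (p : F) ≠ 0) (hα : α ≠ 0) (M : ℕ) (x : ZMod (p ^ (M + 1))) :
    α ^ (M + 1) * ν (M + 1) x = S (M + 1) x +
      α / p * (α ^ M * ν M (ZMod.castHom (pow_dvd_pow p M.le_succ) (ZMod (p ^ M)) x)) := by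
  rw [nu_succ α S ν hν hp M x, mul_add, ← mul_assoc (α ^ (M + 1)) (α⁻¹ ^ (M + 1)), ← mul_pow,
    mul_inv_cancel₀ hα, one_pow, one_mul, pow_succ, div_eq_mul_inv]
  ring

include hν in
omit [Fact p.Prime] in
/-- `α⁰ ν₀ = (1 − α/p)⁻¹ S₀`. [cite: MazurTateTeitelbaum1986Invent, §I.10] -/
theorem alpha_pow_mul_nu_zero (x : ZMod (p ^ 0)) : α ^ 0 * ν 0 x = (1 - α / p)⁻¹ * S 0 0 := by
  rw [pow_zero, one_mul, nu_zero α S ν hν]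

end Recursion

/-! ### §2 Growth of order `½` from a bound on the Mazur–Tate–Teitelbaum ball values -/

section Growth

variable [Fact p.Prime] {c : ℕ} (η : DirichletCharacter ℂ_[p] (p ^ c)) (α : ℂ_[p])
variable (S : (j : ℕ) → ZMod (p ^ j) → ℂ_[p])
variable (ν : (M : ℕ) → ZMod (p ^ M) → ℂ_[p])
variable (ρ : (M : ℕ) → ZMod (p ^ M) → ℂ_[p])
variable (hρ : ∀ (M : ℕ) (y : ZMod (p ^ M)), ρ M y = η⁻¹ ((y.val : ℕ) : ZMod (p ^ c)) * ν M y)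
variable (𝓛 : (n : ℕ) → ZMod (p ^ n) → ℂ_[p])
variable (h𝓛 : ∀ (n : ℕ) (s : ZMod (p ^ n)), 𝓛 n s =
  ∑ᶠ T : rootsOfUnity (torsionOrder p) ℤ_[p],
    ∑ y ∈ Finset.univ.filter (fun y : ZMod (p ^ (c + cyclotomicExponent p + n)) ↦
      ZMod.castHom (pow_dvd_pow p (by omega : cyclotomicExponent p + n ≤ c + cyclotomicExponent p + n))
          (ZMod (p ^ (cyclotomicExponent p + n))) y =
        PadicInt.toZModPow (cyclotomicExponent p + n) ((T : ℤ_[p]ˣ) : ℤ_[p]) *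
          (cyclotomicGenerator p : ZMod (p ^ (cyclotomicExponent p + n))) ^ s.val),
      ρ (c + cyclotomicExponent p + n) y)

include hρ h𝓛 in
/-- **Growth `½` of the pushforward from `‖ν_M(x)‖ ≤ K p^{M/2}`.** The level-`n` ball value of the
candidate `𝓛` is a finite sum of `ρ = η̄·ν` at level `c + e₀ + n`; ultrametrically
`‖𝓛 n s‖ ≤ K p^{(c+e₀)/2} · p^{n/2}`. [cite: Bellaiche2021, Def. 6.2.10] [cite: MazurTateTeitelbaum1986Invent, §I.13] -/
theorem hasGrowthOrder_half_candidate_of_norm_nu_le {K : ℝ}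
    (hK : ∀ (M : ℕ) (x : ZMod (p ^ M)), ‖ν M x‖ ≤ K * (p : ℝ) ^ ((1 / 2 : ℝ) * M)) :
    HasGrowthOrder p (1 / 2) 𝓛 := by
  classical
  haveI := neZero_torsionOrder p
  haveI := Fintype.ofFinite (rootsOfUnity (torsionOrder p) ℤ_[p])
  have hp : p.Prime := Fact.out
  have hp0 : (0 : ℝ) < p := by exact_mod_cast hp.pos
  have hK0 : 0 ≤ K := by
    have h := (norm_nonneg _).trans (hK 0 0)
    simpa using h
  refine ⟨K * (p : ℝ) ^ ((1 / 2 : ℝ) * (c + cyclotomicExponent p : ℕ)), fun n s ↦ ?_⟩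
  have hbound : (0 : ℝ) ≤ K * (p : ℝ) ^ ((1 / 2 : ℝ) * (c + cyclotomicExponent p + n : ℕ)) := by positivity
  have hρle : ∀ y : ZMod (p ^ (c + cyclotomicExponent p + n)),
      ‖ρ (c + cyclotomicExponent p + n) y‖ ≤ K * (p : ℝ) ^ ((1 / 2 : ℝ) * (c + cyclotomicExponent p + n : ℕ)) := by
    intro y
    rw [hρ, norm_mul]
    calc ‖η⁻¹ ((y.val : ℕ) : ZMod (p ^ c))‖ * ‖ν (c + cyclotomicExponent p + n) y‖
        ≤ 1 * (K * (p : ℝ) ^ ((1 / 2 : ℝ) * (c + cyclotomicExponent p + n : ℕ))) :=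
          mul_le_mul (η⁻¹.norm_le_one _) (hK _ y) (norm_nonneg _) zero_le_one
      _ = _ := one_mul _
  rw [h𝓛, finsum_eq_sum_of_fintype]
  calc ‖_‖ ≤ K * (p : ℝ) ^ ((1 / 2 : ℝ) * (c + cyclotomicExponent p + n : ℕ)) := by
        refine IsUltrametricDist.norm_sum_le_of_forall_le_of_nonneg hbound fun T _ ↦ ?_
        exact IsUltrametricDist.norm_sum_le_of_forall_le_of_nonneg hbound fun y _ ↦ hρle y
    _ = K * (p : ℝ) ^ ((1 / 2 : ℝ) * (c + cyclotomicExponent p : ℕ)) * (p : ℝ) ^ ((1 / 2 : ℝ) * n) := by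
        rw [mul_assoc, ← Real.rpow_add hp0]
        push_cast
        ring_nf

/-- **From `Φ_M = α^M ν_M` bounded to `‖ν_M‖ ≤ C p^{M/2}`** when `‖α⁻¹‖ ≤ √p` (slope `≤ ½`).
[cite: MazurTateTeitelbaum1986Invent, §I.11] [cite: Bellaiche2021, Thm. 6.7.9 (growth rate)] -/
theorem norm_nu_le_of_norm_alpha_pow_mul_nu_le (hα : α ≠ 0) (hαn : ‖α⁻¹‖ ≤ (p : ℝ) ^ (1 / 2 : ℝ))
    {C : ℝ} (hC : ∀ (M : ℕ) (x : ZMod (p ^ M)), ‖α ^ M * ν M x‖ ≤ C) (M : ℕ) (x : ZMod (p ^ M)) :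
    ‖ν M x‖ ≤ C * (p : ℝ) ^ ((1 / 2 : ℝ) * M) := by
  have hp : p.Prime := Fact.out
  have hp0 : (0 : ℝ) < p := by exact_mod_cast hp.pos
  have hC0 : 0 ≤ C := (norm_nonneg _).trans (hC 0 0)
  have hαM : ν M x = α⁻¹ ^ M * (α ^ M * ν M x) := by
    rw [← mul_assoc, ← mul_pow, inv_mul_cancel₀ hα, one_pow, one_mul]
  rw [hαM, norm_mul, norm_pow, mul_comm]
  refine mul_le_mul (hC M x) ?_ (by positivity) hC0
  calc ‖α⁻¹‖ ^ M ≤ ((p : ℝ) ^ (1 / 2 : ℝ)) ^ M := pow_le_pow_left₀ (norm_nonneg _) hαn M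
    _ = (p : ℝ) ^ ((1 / 2 : ℝ) * M) := by rw [← Real.rpow_natCast, ← Real.rpow_mul hp0.le]

end Growth

/-! ### §3 Over a coefficient field: a finitely generated `ℤ`-module maps to a bounded set of `ℂ_p` -/

section Bounded

variable [Fact p.Prime] {K : Type*} [Field K]

/-- **Lattice ⟹ bounded.** The image under a ring homomorphism `ι : K →+* ℂ_p` of a finitely generated
`ℤ`-submodule of `K` is bounded: `‖n‖ ≤ 1` for `n ∈ ℤ` and the ultrametric inequality. [folklore] -/
theorem exists_norm_map_le_of_fg (ι : K →+* ℂ_[p]) {Λ : Submodule ℤ K} (hΛ : Λ.FG) :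
    ∃ C : ℝ, 0 ≤ C ∧ ∀ x ∈ Λ, ‖ι x‖ ≤ C := by
  classical
  obtain ⟨s, hs⟩ := hΛ
  refine ⟨∑ v ∈ s, ‖ι v‖, Finset.sum_nonneg fun v _ ↦ norm_nonneg _, fun x hx ↦ ?_⟩
  rw [← hs] at hx
  refine Submodule.span_induction (p := fun y _ ↦ ‖ι y‖ ≤ ∑ v ∈ s, ‖ι v‖) ?_ ?_ ?_ ?_ hx
  · intro v hv
    exact Finset.single_le_sum (f := fun v ↦ ‖ι v‖) (fun v _ ↦ norm_nonneg _) (Finset.mem_coe.mp hv)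
  · simp only [map_zero, norm_zero]
    exact Finset.sum_nonneg fun v _ ↦ norm_nonneg _
  · intro y z _ _ hy hz
    rw [map_add]
    exact (IsUltrametricDist.norm_add_le_max _ _).trans (max_le hy hz)
  · intro n y _ hy
    rw [zsmul_eq_mul, map_mul, map_intCast, norm_mul]
    exact (mul_le_of_le_one_left (norm_nonneg _) (IsUltrametricDist.norm_intCast_le_one _ n)).trans hy

end Bounded

end Summit.BirchSwinnertonDyer.BirchSwinnertonDyer.Theorems.PSF1OfLattice

end
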